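import Summits.BirchSwinnertonDyer.BirchSwinnertonDyer.Theorems.ResidualThetaTransportAtTwoThetaLayerLambdaCongruenceAtTwoCuspSpanThreePrimesReduction
import Summits.BirchSwinnertonDyer.BirchSwinnertonDyer.Theorems.ResidualThetaTransportAtTwoThetaLayerLambdaCongruenceAtTwoCuspSpanPotentialMoves
import Summits.BirchSwinnertonDyer.BirchSwinnertonDyer.Theorems.ResidualThetaTransportAtTwoThetaLayerLambdaCongruenceAtTwoCuspSpanTwoPrimes
import HarnessLib

/-!
# Route `ResidualThetaTransportAtTwo`, cruxes Kan⁺ (stmt-BirchSwinnertonDyer-20688) / node 27436 / 21437: **the node at the first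
# three-prime level, `CuspSpanEvenAtTwo 105`** — a move certificate

Cell `bsd-wall`, lead prover `bsd-wall-rtt-p3` g10 (2026-08-28). THEOREMS ONLY (no `def`, no `sorry`);
`--supports stmt-BirchSwinnertonDyer-20688`; BSD is not proved by this.

`…CuspSpanThreePrimesReduction` reduces the node at `N = pqr` to the CERTIFICATE OBLIGATION «every normalised potential `φ` of an
admissible `χ` vanishes at the cusps `1/w` of the three single-prime types». Here the obligation is discharged at `N = 105 = 3·5·7`
(types `3, 5, 7`, colevels `35, 21, 15`: `24 + 12 + 8 = 44` residue classes) by an explicit spanning tree of MOVES found by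
`analysis/cert105.py` (attached to the crux item): `B₁`-moves `φ(1, 1−u) = φ(1, x)` (`(x+1)u + Nk = 1`, `phi_one_one_sub_eq`),
dilations `φ(1, δ) = φ(1, w)` (`bδ = 4^k − 1`, `N ∣ δ − 4^k w`, `phi_one_eq_of_mul_eq_four_pow_sub_one`), signed dilations
(`bδ = −(4^k+1)`, `phi_one_eq_of_mul_eq_neg_four_pow_add_one`) and `N`-periodicity, every class being linked to the anchor
`φ(1, d) = 0` (`d ∈ {3, 5, 7}`); `k ≤ 10` suffices. Consequences: **`cuspSpanEvenAtTwo_105`** (the node — hence Kμ⁺'s FLAT — at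
the smallest odd conductor with three prime factors, the first node instance beyond prime powers and two primes) and
`flatAtTwo_of_conductor_105`.

References: [Manin1972] §1.6–1.7, Thm. 1.9; [Pollack2003] Conj. 6.3, Prop. 6.18.
-/

set_option autoImplicit false
set_option linter.dupNamespace false

noncomputable section

open scoped MatrixGroups

open CongruenceSubgroup WeierstrassCurve Literature.NumberTheory.EllipticCurves
  Literature.NumberTheory.EllipticCurves.ModularForms Literature.NumberTheory.EllipticCurves.Rank1Residual
  Literature.NumberTheory.IwasawaTheory Summit.BirchSwinnertonDyer.Rank1Residual.Supersingular

namespace Summit.BirchSwinnertonDyer.BirchSwinnertonDyer.Theorems.SignedMuAtTwo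

namespace Potential

/-- **The single-type certificate at `N = 105`.** For an admissible `χ : Γ₀(105) → 𝔽₂` (kills trace `±2`, the `4^k`-classes and
`B₁`) and a potential `φ` with `φ(1, d) = 0` for `d ∣ 105`: `φ(1, w) = 0` whenever exactly one of `3, 5, 7` divides `w`.
Proof: 44 explicit moves (spanning trees of the move graph on the residue classes of types `3, 5, 7`), then reduction of `w`
mod `105`. [cite: Manin1972, §1.6] [cite: Pollack2003, Conj. 6.3] -/
theorem phi_one_eq_zero_singleTypes_105 {χ : Gamma0 105 → ZMod 2} {φ : ℤ → ℤ → ZMod 2}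
    (hsmall : ∀ γ : Gamma0 105, ((γ : SL(2, ℤ)) 0 0 + (γ : SL(2, ℤ)) 1 1).natAbs ≤ 2 → χ γ = 0)
    (hkill : ∀ γ : Gamma0 105, (∃ k : ℕ, 1 ≤ k ∧ ((γ : SL(2, ℤ)) 1 1).natAbs = 4 ^ k) → χ γ = 0)
    (hB1 : ∀ β : Gamma0 105, (β : SL(2, ℤ)) 0 1 = -1 → χ β = 0)
    (hφ : ∀ (γ : Gamma0 105) (x y : ℤ), IsCoprime x y →
      φ ((γ : SL(2, ℤ)) 0 0 * x + (γ : SL(2, ℤ)) 0 1 * y) ((γ : SL(2, ℤ)) 1 0 * x + (γ : SL(2, ℤ)) 1 1 * y) = χ γ + φ x y)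
    (hbase : ∀ d : ℕ, d ∣ 105 → φ 1 d = 0) (w : ℤ)
    (hw : (((3 : ℕ) : ℤ) ∣ w ∧ ¬ ((5 : ℕ) : ℤ) ∣ w ∧ ¬ ((7 : ℕ) : ℤ) ∣ w) ∨
      (¬ ((3 : ℕ) : ℤ) ∣ w ∧ ((5 : ℕ) : ℤ) ∣ w ∧ ¬ ((7 : ℕ) : ℤ) ∣ w) ∨
      (¬ ((3 : ℕ) : ℤ) ∣ w ∧ ¬ ((5 : ℕ) : ℤ) ∣ w ∧ ((7 : ℕ) : ℤ) ∣ w)) :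
    φ 1 w = 0 := by
  -- type 3 (colevel 35): 24 classes
  have a3 : φ 1 3 = 0 := by exact_mod_cast hbase 3 (by norm_num)
  have a27 : φ 1 27 = 0 := by
    have h := phi_one_one_sub_eq hφ hB1 (x := 3) (u := -26) (k := 1) (by norm_num)
    norm_num at h
    rw [h]; exact a3
  have a51 : φ 1 51 = 0 := by
    have h := phi_one_one_sub_eq hφ hB1 (x := 51) (u := -2) (k := 1) (by norm_num)
    norm_num at h
    rw [← h]; exact a3
  have a33 : φ 1 33 = 0 := by
    have h := phi_one_eq_of_mul_eq_four_pow_sub_one hφ hkill (w := 33) (δ := 3) (b := 5) (k := 2) (by norm_num) (by norm_num) (by norm_num)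
    rw [← h]; exact a3
  have a87 : φ 1 87 = 0 := by
    have h := phi_one_eq_of_mul_eq_four_pow_sub_one hφ hkill (w := 87) (δ := 3) (b := 21) (k := 3) (by norm_num) (by norm_num) (by norm_num)
    rw [← h]; exact a3
  have a81 : φ 1 81 = 0 := by
    have h := phi_one_one_sub_eq hφ hB1 (x := 81) (u := -32) (k := 25) (by norm_num)
    norm_num at h
    rw [← h]; exact a33
  have a72 : φ 1 72 = 0 := by
    have h := phi_one_one_sub_eq hφ hB1 (x := 33) (u := -71) (k := 23) (by norm_num)
    norm_num at h
    rw [h]; exact a33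
  have a48 : φ 1 48 = 0 := by
    have h := phi_one_eq_of_mul_eq_four_pow_sub_one hφ hkill (w := 48) (δ := 3) (b := 85) (k := 4) (by norm_num) (by norm_num) (by norm_num)
    rw [← h]; exact a3
  have a9 : φ 1 9 = 0 := by
    have h := phi_one_eq_of_mul_eq_four_pow_sub_one hφ hkill (w := 51) (δ := 9) (b := 7) (k := 3) (by norm_num) (by norm_num) (by norm_num)
    rw [h]; exact a51
  have a24 : φ 1 24 = 0 := by
    have h := phi_one_one_sub_eq hφ hB1 (x := 72) (u := -23) (k := 16) (by norm_num)
    norm_num at h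
    rw [h]; exact a72
  have a93 : φ 1 93 = 0 := by
    have h := phi_one_one_sub_eq hφ hB1 (x := 93) (u := -86) (k := 77) (by norm_num)
    norm_num at h
    rw [← h]; exact a87
  have a69 : φ 1 69 = 0 := by
    have h := phi_one_one_sub_eq hφ hB1 (x := 87) (u := -68) (k := 57) (by norm_num)
    norm_num at h
    rw [h]; exact a87
  have a12 : φ 1 12 = 0 := by
    have h := phi_one_eq_of_mul_eq_four_pow_sub_one hφ hkill (w := 12) (δ := 3) (b := 341) (k := 5) (by norm_num) (by norm_num) (by norm_num)
    rw [← h]; exact a3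
  have a66 : φ 1 66 = 0 := by
    have h := phi_one_one_sub_eq hφ hB1 (x := 66) (u := -47) (k := 30) (by norm_num)
    norm_num at h
    rw [← h]; exact a48
  have a96 : φ 1 96 = 0 := by
    have h := phi_one_one_sub_eq hφ hB1 (x := 96) (u := -92) (k := 85) (by norm_num)
    norm_num at h
    rw [← h]; exact a93
  have a18 : φ 1 18 = 0 := by
    have h := phi_one_one_sub_eq hφ hB1 (x := 18) (u := -11) (k := 2) (by norm_num)
    norm_num at h
    rw [← h]; exact a12
  have a36 : φ 1 36 = 0 := by
    have h := phi_one_one_sub_eq hφ hB1 (x := 36) (u := -17) (k := 6) (by norm_num)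
    norm_num at h
    rw [← h]; exact a18
  have a102 : φ 1 102 = 0 := by
    have h := phi_one_eq_of_mul_eq_four_pow_sub_one hφ hkill (w := 72) (δ := -3) (b := -5) (k := 2) (by norm_num) (by norm_num) (by norm_num)
    have hp : φ 1 (-3) = φ 1 102 := phi_one_eq_of_dvd_sub hsmall hφ (by norm_num)
    rw [← hp, h]; exact a72
  have a78 : φ 1 78 = 0 := by
    have h := phi_one_one_sub_eq hφ hB1 (x := 78) (u := -101) (k := 76) (by norm_num)
    norm_num at h
    rw [← h]; exact a102
  have a54 : φ 1 54 = 0 := by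
    have h := phi_one_one_sub_eq hφ hB1 (x := 102) (u := -53) (k := 52) (by norm_num)
    norm_num at h
    rw [h]; exact a102
  have a57 : φ 1 57 = 0 := by
    have h := phi_one_eq_of_mul_eq_four_pow_sub_one hφ hkill (w := 57) (δ := 93) (b := 11) (k := 5) (by norm_num) (by norm_num) (by norm_num)
    rw [← h]; exact a93
  have a39 : φ 1 39 = 0 := by
    have h := phi_one_one_sub_eq hφ hB1 (x := 57) (u := -38) (k := 21) (by norm_num)
    norm_num at h
    rw [h]; exact a57
  have a99 : φ 1 99 = 0 := by
    have h := phi_one_eq_of_mul_eq_four_pow_sub_one hφ hkill (w := 99) (δ := -129) (b := -127) (k := 7) (by norm_num) (by norm_num) (by norm_num)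
    have hp : φ 1 (-129) = φ 1 81 := phi_one_eq_of_dvd_sub hsmall hφ (by norm_num)
    rw [← h, hp]; exact a81
  have a6 : φ 1 6 = 0 := by
    have h := phi_one_eq_of_mul_eq_four_pow_sub_one hφ hkill (w := 6) (δ := 129) (b := 127) (k := 7) (by norm_num) (by norm_num) (by norm_num)
    have hp : φ 1 129 = φ 1 24 := phi_one_eq_of_dvd_sub hsmall hφ (by norm_num)
    rw [← h, hp]; exact a24
  -- type 5 (colevel 21): 12 classes
  have a5 : φ 1 5 = 0 := by exact_mod_cast hbase 5 (by norm_num)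
  have a25 : φ 1 25 = 0 := by
    have h := phi_one_one_sub_eq hφ hB1 (x := 25) (u := -4) (k := 1) (by norm_num)
    norm_num at h
    rw [← h]; exact a5
  have a20 : φ 1 20 = 0 := by
    have h := phi_one_eq_of_mul_eq_four_pow_sub_one hφ hkill (w := 20) (δ := 5) (b := 3) (k := 2) (by norm_num) (by norm_num) (by norm_num)
    rw [← h]; exact a5
  have a100 : φ 1 100 = 0 := by
    have h := phi_one_eq_of_mul_eq_neg_four_pow_add_one hsmall hφ hkill (w := 5) (δ := 5) (b := -13) (k := 3) (by norm_num) (by norm_num) (by norm_num)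
    have hp : φ 1 (-5) = φ 1 100 := phi_one_eq_of_dvd_sub hsmall hφ (by norm_num)
    rw [← hp, h]; exact a5
  have a10 : φ 1 10 = 0 := by
    have h := phi_one_one_sub_eq hφ hB1 (x := 10) (u := -19) (k := 2) (by norm_num)
    norm_num at h
    rw [← h]; exact a20
  have a80 : φ 1 80 = 0 := by
    have h := phi_one_eq_of_mul_eq_four_pow_sub_one hφ hkill (w := 80) (δ := 5) (b := 51) (k := 4) (by norm_num) (by norm_num) (by norm_num)
    rw [← h]; exact a5
  have a85 : φ 1 85 = 0 := by
    have h := phi_one_eq_of_mul_eq_neg_four_pow_add_one hsmall hφ hkill (w := 85) (δ := -5) (b := 205) (k := 5) (by norm_num) (by norm_num) (by norm_num)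
    norm_num at h
    rw [← h]; exact a5
  have a95 : φ 1 95 = 0 := by
    have h := phi_one_one_sub_eq hφ hB1 (x := 85) (u := -94) (k := 77) (by norm_num)
    norm_num at h
    rw [h]; exact a85
  have a65 : φ 1 65 = 0 := by
    have h := phi_one_eq_of_mul_eq_neg_four_pow_add_one hsmall hφ hkill (w := 10) (δ := 145) (b := -113) (k := 7) (by norm_num) (by norm_num) (by norm_num)
    have hp : φ 1 (-145) = φ 1 65 := phi_one_eq_of_dvd_sub hsmall hφ (by norm_num)
    rw [← hp, h]; exact a10
  have a40 : φ 1 40 = 0 := by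
    have h := phi_one_one_sub_eq hφ hB1 (x := 40) (u := -64) (k := 25) (by norm_num)
    norm_num at h
    rw [← h]; exact a65
  have a50 : φ 1 50 = 0 := by
    have h := phi_one_eq_of_mul_eq_four_pow_sub_one hφ hkill (w := 65) (δ := -55) (b := -19065) (k := 10) (by norm_num) (by norm_num) (by norm_num)
    have hp : φ 1 (-55) = φ 1 50 := phi_one_eq_of_dvd_sub hsmall hφ (by norm_num)
    rw [← hp, h]; exact a65
  have a55 : φ 1 55 = 0 := by
    have h := phi_one_eq_of_mul_eq_four_pow_sub_one hφ hkill (w := 40) (δ := 55) (b := 19065) (k := 10) (by norm_num) (by norm_num) (by norm_num)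
    rw [h]; exact a40
  -- type 7 (colevel 15): 8 classes
  have a7 : φ 1 7 = 0 := by exact_mod_cast hbase 7 (by norm_num)
  have a14 : φ 1 14 = 0 := by
    have h := phi_one_one_sub_eq hφ hB1 (x := 7) (u := -13) (k := 1) (by norm_num)
    norm_num at h
    rw [h]; exact a7
  have a28 : φ 1 28 = 0 := by
    have h := phi_one_eq_of_mul_eq_four_pow_sub_one hφ hkill (w := 28) (δ := 7) (b := 9) (k := 3) (by norm_num) (by norm_num) (by norm_num)
    rw [← h]; exact a7
  have a77 : φ 1 77 = 0 := by
    have h := phi_one_one_sub_eq hφ hB1 (x := 28) (u := -76) (k := 21) (by norm_num)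
    norm_num at h
    rw [h]; exact a28
  have a98 : φ 1 98 = 0 := by
    have h := phi_one_eq_of_mul_eq_four_pow_sub_one hφ hkill (w := 77) (δ := -7) (b := -9) (k := 3) (by norm_num) (by norm_num) (by norm_num)
    have hp : φ 1 (-7) = φ 1 98 := phi_one_eq_of_dvd_sub hsmall hφ (by norm_num)
    rw [← hp, h]; exact a77
  have a91 : φ 1 91 = 0 := by
    have h := phi_one_one_sub_eq hφ hB1 (x := 91) (u := -97) (k := 85) (by norm_num)
    norm_num at h
    rw [← h]; exact a98
  have a56 : φ 1 56 = 0 := by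
    have h := phi_one_eq_of_mul_eq_four_pow_sub_one hφ hkill (w := 56) (δ := -511) (b := -513) (k := 9) (by norm_num) (by norm_num) (by norm_num)
    have hp : φ 1 (-511) = φ 1 14 := phi_one_eq_of_dvd_sub hsmall hφ (by norm_num)
    rw [← h, hp]; exact a14
  have a49 : φ 1 49 = 0 := by
    have h := phi_one_eq_of_mul_eq_four_pow_sub_one hφ hkill (w := 49) (δ := 511) (b := 513) (k := 9) (by norm_num) (by norm_num) (by norm_num)
    have hp : φ 1 511 = φ 1 91 := phi_one_eq_of_dvd_sub hsmall hφ (by norm_num)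
    rw [← h, hp]; exact a91

  -- reduction mod 105
  push_cast at hw
  have hqr : w = 105 * (w / 105) + w % 105 := (Int.mul_ediv_add_emod w 105).symm
  have hr0 : 0 ≤ w % 105 := Int.emod_nonneg w (by norm_num)
  have hr1 : w % 105 < 105 := Int.emod_lt_of_pos w (by norm_num)
  generalize w / 105 = q at hqr
  generalize w % 105 = r at hqr hr0 hr1
  rw [phi_one_eq_of_dvd_sub hsmall hφ (w := r) (w' := w) ⟨q, by push_cast; omega⟩]
  interval_cases r <;> first | assumption | (exfalso; omega)

end Potential

/-- **The node at `N = 105 = 3·5·7`**: `CuspSpanEvenAtTwo 105` — the first three-prime level (reduction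
`cuspSpanEvenAtTwo_threePrimes_of_singleTypes` + the certificate `phi_one_eq_zero_singleTypes_105`). BSD is not proved by this.
[cite: Pollack2003, Conj. 6.3] [cite: Manin1972, Thm. 1.9] -/
theorem cuspSpanEvenAtTwo_105 : CuspSpanEvenAtTwo 105 :=
  Potential.cuspSpanEvenAtTwo_threePrimes_of_singleTypes (p := 3) (q := 5) (r := 7) Nat.prime_three Nat.prime_five
    (by norm_num) (by decide) (by decide) (by decide) (by decide) (by decide) (by decide) rfl
    fun _χ _φ _hadd hsmall hkill hB1 hφ _h01 hbase w hw ↦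
      Potential.phi_one_eq_zero_singleTypes_105 hsmall hkill hB1 hφ hbase w hw

/-- `CuspSpanEvenAtTwo N` for `N = 105` (substitution form, for conductors given by an equation). [cite: Pollack2003, Conj. 6.3] -/
theorem cuspSpanEvenAtTwo_of_eq_105 {N : ℕ} [NeZero N] (hN : N = 105) : CuspSpanEvenAtTwo N := by
  subst hN
  exact cuspSpanEvenAtTwo_105

section Flat

variable {W : WeierstrassCurve ℚ} [W.IsElliptic] [W.IsGloballyMinimal]

/-- **FLAT at conductor `105`.** For `W/ℚ` good supersingular at `2` with `a₂(W) = 0`, newform `f`, and conductor `105`: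
`2 ∤ L⁻` for every Pollack pair `(L⁺, L⁻)` of `f` at `2`. BSD is not proved by this. [cite: Pollack2003, Conj. 6.3 and Prop. 6.18] -/
theorem flatAtTwo_of_conductor_105 [NeZero (W.conductorNorm ℤ)] {f : CuspForm (Gamma0 (W.conductorNorm ℤ)) 2}
    (hf : IsNewformOf W f) (hss : GoodSS W 2) (ha2 : W.frobeniusTrace 2 = 0) (hN : W.conductorNorm ℤ = 105) :
    ∀ Lplus Lminus : IwasawaAlgebra 2, IsPollackPair f 2 Lplus Lminus → ¬ PowerSeries.C (2 : ℤ_[2]) ∣ Lminus :=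
  flatAtTwo_of_cuspSpanEvenAtTwo hf hss ha2 (cuspSpanEvenAtTwo_of_eq_105 hN)

end Flat

end Summit.BirchSwinnertonDyer.BirchSwinnertonDyer.Theorems.SignedMuAtTwo

end
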